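import Literature.Analysis.FluidPDE.PlanarGeneratorAssembly
import HarnessLib

/-!
# Straight move: the gate template datum

Topic `Literature/Analysis/FluidPDE`. Emitted data / kernel certificates of the explicit straight generating
move (`S`) in the typed-chain model, under the contract of `PlanarGeneratorAssembly.lean`
(`acm_compatible_blocks_of_slots`). Generated by the author's emitter from the exact rational design;
no named facts, every theorem is decided in the kernel or assembled from decided chunks. [folklore]

## References

* G. Alberti, G. Crippa, A. L. Mazzucato, *Exponential self-similar mixing by incompressible
  flows*, J. Amer. Math. Soc. 32 (2019), 445–490, §8 (arXiv:1605.02090).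
-/

namespace Literature.Analysis.FluidPDE.QuasiSelfSimilar.MoveS

open PlanarKinematics QuasiSelfSimilar

/-- The gate template datum of the design: squeeze clock `[0, 1/15]`, slope schedule `1 → 1/5`, stub box transverse half-extent `29/1600`, transition `3/1600`, margin `1/50`. [folklore] -/
def C_S : GateC := ⟨0, (mkRat (1) 15), ⟨1, (mkRat (1) 5)⟩, (mkRat (29) 1600), (mkRat (3) 1600), (mkRat (1) 50)⟩

end Literature.Analysis.FluidPDE.QuasiSelfSimilar.MoveS
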